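import Mathlib.LinearAlgebra.JordanChevalley
import Literature.NumberTheory.Automorphic.LinearAlgebraicGroups
import HarnessLib

/-!
# The multiplicative Jordan decomposition in `GL n k` (Springer 2.4.4–2.4.5)

Trunk T-AUTOMORPHIC (G25 AutomorphicL); theorems over the vocabulary of
`LinearAlgebraicGroups.lean` (namespace `Literature.Automorphic`): `IsSemisimpleElt g`
(`Module.End.IsSemisimple` of the endomorphism of `kⁿ`), `IsUnipotentElt g` (`g - 1` nilpotent).
Springer, *Linear Algebraic Groups* (2nd ed.), 2.4.4–2.4.5: every `g ∈ GL(V)` (`k` perfect, in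
particular algebraically closed) is uniquely `g = g_s g_u = g_u g_s` with `g_s` semisimple and
`g_u` unipotent. Proved here:

* `IsJordanDecomp g s u` — the predicate "`(s, u)` is a Jordan decomposition of `g`";
* `exists_isJordanDecomp` — existence, from Mathlib's additive Jordan–Chevalley decomposition
  `f = n + s` (`Module.End.exists_isNilpotent_isSemisimple`, `k` perfect): `s` is invertible
  (`f` is and `n` is a commuting nilpotent) and `u = s⁻¹ g = 1 + s⁻¹ n`;
* `IsJordanDecomp.unique`, `existsUnique_isJordanDecomp` — uniqueness, from Mathlib's
  `Module.End.isNilpotent_isSemisimple_unique` applied to `f = s (u - 1) + s`.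

This is the `GL n`-half of Springer 2.4.8 (`g_s, g_u ∈ G` for `g` in a closed subgroup `G`),
whose other half needs the right-translation representation (`RightTranslationGL.lean`).

## References

* [SpringerLAG1998] T. A. Springer, *Linear Algebraic Groups*, 2nd ed., Progress in
  Mathematics 9, Birkhäuser (1998): 2.4.4, 2.4.5, 2.4.8.
-/

open scoped MatrixGroups

namespace Literature.NumberTheory.Automorphic

variable {k : Type*} [Field k] {n : Type*} [Fintype n] [DecidableEq n]

/-! ### The multiplicative Jordan decomposition in `GL n k` (Springer 2.4.4–2.4.5) -/

section Jordan

/-- `(s, u)` is a *(multiplicative) Jordan decomposition* of `g ∈ GL n k`: `g = s u = u s` with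
`s` semisimple and `u` unipotent (Springer 2.4.5). [folklore] -/
structure IsJordanDecomp (g s u : GL n k) : Prop where
  semisimple : IsSemisimpleElt s
  unipotent : IsUnipotentElt u
  mul_eq : s * u = g
  commute : Commute s u

/-- `toLin'` of a product in `GL n k`. [folklore] -/
lemma toLin'_coe_mul (a b : GL n k) :
    Matrix.toLin' ((a * b : GL n k) : Matrix n n k) =
      Matrix.toLin' (a : Matrix n n k) * Matrix.toLin' (b : Matrix n n k) := by
  rw [Units.val_mul, Matrix.toLin'_mul, Module.End.mul_eq_comp]

/-- Matrices commute iff their `toLin'` do. [folklore] -/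
lemma commute_toLin'_iff {a b : Matrix n n k} :
    Commute (Matrix.toLin' a) (Matrix.toLin' b) ↔ Commute a b := by
  constructor
  · intro h
    have e := congrArg LinearMap.toMatrix' h.eq
    simp only [Module.End.mul_eq_comp, ← Matrix.toLin'_mul, LinearMap.toMatrix'_toLin'] at e
    exact e
  · intro h
    have e := congrArg Matrix.toLin' h.eq
    simp only [Matrix.toLin'_mul, ← Module.End.mul_eq_comp] at e
    exact e

/-- **Existence of the Jordan decomposition in `GL n k`** (Springer 2.4.4 (i)–2.4.5) over a
perfect field: from Mathlib's additive Jordan–Chevalley decomposition `f = n + s`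
(`Module.End.exists_isNilpotent_isSemisimple`) of `f = g` acting on `kⁿ`, with `s` invertible
(`f` is, `n` is nilpotent) and `u = s⁻¹ g = 1 + s⁻¹ n`. [cite: SpringerLAG1998, 2.4.4–2.4.5] -/
theorem exists_isJordanDecomp [PerfectField k] (g : GL n k) :
    ∃ s u : GL n k, IsJordanDecomp g s u := by
  set f : Module.End k (n → k) := Matrix.toLin' ((g : GL n k) : Matrix n n k) with hf
  obtain ⟨N, hN, S, hS, hNnil, hSss, hfNS⟩ := f.exists_isNilpotent_isSemisimple
  have hNf : Commute N f := (Algebra.commute_of_mem_adjoin_self hN).symm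
  have hSf : Commute S f := (Algebra.commute_of_mem_adjoin_self hS).symm
  -- `f` and hence `S = f - N` are invertible
  have hfunit : IsUnit f := by
    refine ⟨⟨f, Matrix.toLin' ((g⁻¹ : GL n k) : Matrix n n k), ?_, ?_⟩, rfl⟩
    · rw [hf, ← toLin'_coe_mul, mul_inv_cancel, Units.val_one, Matrix.toLin'_one]
      rfl
    · rw [hf, ← toLin'_coe_mul, inv_mul_cancel, Units.val_one, Matrix.toLin'_one]
      rfl
  have hSeq : S = -N + f := by rw [hfNS]; abel
  have hSunit : IsUnit S := by
    rw [hSeq]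
    exact hNnil.neg.isUnit_add_right_of_commute hfunit hNf.neg_left
  -- the matrix of `S`, as an element of `GL n k`
  have hSmat : IsUnit (LinearMap.toMatrix' S) := hSunit.map LinearMap.toMatrixAlgEquiv'
  set s : GL n k := hSmat.unit with hs
  have hsS : Matrix.toLin' ((s : GL n k) : Matrix n n k) = S := by
    rw [hs, IsUnit.unit_spec, Matrix.toLin'_toMatrix']
  -- `s` commutes with `g`
  have hsg : Commute ((s : GL n k) : Matrix n n k) ((g : GL n k) : Matrix n n k) := by
    rw [← commute_toLin'_iff, hsS, ← hf]
    exact hSf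
  have hsg' : Commute s g := Units.ext hsg.eq
  refine ⟨s, s⁻¹ * g, ?_, ?_, by rw [mul_inv_cancel_left], ?_⟩
  · -- semisimple
    show Module.End.IsSemisimple (Matrix.toLin' ((s : GL n k) : Matrix n n k))
    rwa [hsS]
  · -- unipotent: `s⁻¹ g - 1 = s⁻¹ (g - s)` and `toLin' (g - s) = N`
    show IsNilpotent (((s⁻¹ * g : GL n k) : Matrix n n k) - 1)
    have e : ((s⁻¹ * g : GL n k) : Matrix n n k) - 1 =
        ((s⁻¹ : GL n k) : Matrix n n k) * (((g : GL n k) : Matrix n n k) - (s : Matrix n n k)) := by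
      rw [Matrix.mul_sub, Units.val_mul, Units.inv_mul]
    rw [e]
    have hN' : Matrix.toLin' (((g : GL n k) : Matrix n n k) - (s : Matrix n n k)) = N := by
      rw [map_sub, hsS, ← hf, hfNS, add_sub_cancel_right]
    have hnil : IsNilpotent (((g : GL n k) : Matrix n n k) - (s : Matrix n n k)) := by
      have h := hNnil.map LinearMap.toMatrixAlgEquiv'
      change IsNilpotent (LinearMap.toMatrix' N) at h
      rwa [← hN', LinearMap.toMatrix'_toLin'] at h
    exact Commute.isNilpotent_mul_left (hsg.sub_right (Commute.refl _)).units_inv_left hnil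
  · -- commute
    calc s * (s⁻¹ * g) = g := mul_inv_cancel_left s g
      _ = s⁻¹ * (s * g) := (inv_mul_cancel_left s g).symm
      _ = s⁻¹ * (g * s) := by rw [hsg'.eq]
      _ = s⁻¹ * g * s := (mul_assoc _ _ _).symm

/-- **Uniqueness of the Jordan decomposition in `GL n k`** (Springer 2.4.4 (i), 2.4.5), from
Mathlib's uniqueness of the additive decomposition (`Module.End.isNilpotent_isSemisimple_unique`)
applied to `f = s (u - 1) + s`. [cite: SpringerLAG1998, 2.4.4–2.4.5] -/
theorem IsJordanDecomp.unique [PerfectField k] {g s u s' u' : GL n k} (h : IsJordanDecomp g s u)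
    (h' : IsJordanDecomp g s' u') : s = s' ∧ u = u' := by
  -- the additive decomposition `f = S (U - 1) + S` attached to `(s, u)`
  have key : ∀ {s u : GL n k}, IsJordanDecomp g s u →
      IsNilpotent (Matrix.toLin' ((s : GL n k) : Matrix n n k) *
          (Matrix.toLin' ((u : GL n k) : Matrix n n k) - 1)) ∧
        Commute (Matrix.toLin' ((s : GL n k) : Matrix n n k) *
          (Matrix.toLin' ((u : GL n k) : Matrix n n k) - 1))
          (Matrix.toLin' ((s : GL n k) : Matrix n n k)) ∧
        Matrix.toLin' ((s : GL n k) : Matrix n n k) *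
            (Matrix.toLin' ((u : GL n k) : Matrix n n k) - 1) +
          Matrix.toLin' ((s : GL n k) : Matrix n n k) = Matrix.toLin' ((g : GL n k) : Matrix n n k) := by
    intro s u hsu
    have hcomm : Commute (Matrix.toLin' ((s : GL n k) : Matrix n n k))
        (Matrix.toLin' ((u : GL n k) : Matrix n n k)) :=
      commute_toLin'_iff.2 (congrArg Units.val hsu.commute.eq)
    have hU : IsNilpotent (Matrix.toLin' ((u : GL n k) : Matrix n n k) - 1) := by
      have h1 := hsu.unipotent.map Matrix.toLinAlgEquiv'
      change IsNilpotent (Matrix.toLin' (((u : GL n k) : Matrix n n k) - 1)) at h1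
      rwa [map_sub, Matrix.toLin'_one] at h1
    have h1 : Commute (Matrix.toLin' ((s : GL n k) : Matrix n n k))
        (Matrix.toLin' ((u : GL n k) : Matrix n n k) - 1) := hcomm.sub_right (Commute.one_right _)
    refine ⟨h1.isNilpotent_mul_left hU, Commute.mul_left (Commute.refl _) h1.symm, ?_⟩
    rw [mul_sub, mul_one, sub_add_cancel, ← toLin'_coe_mul, hsu.mul_eq]
  obtain ⟨hn, hc, he⟩ := key h
  obtain ⟨hn', hc', he'⟩ := key h'
  have huniq := Module.End.isNilpotent_isSemisimple_unique hn h.semisimple hn' h'.semisimple hc hc'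
    (he.trans he'.symm)
  have hss' : s = s' := by
    have e' := congrArg LinearMap.toMatrix' huniq.2
    simp only [LinearMap.toMatrix'_toLin'] at e'
    exact Units.ext e'
  refine ⟨hss', ?_⟩
  have e1 := h.mul_eq
  rw [hss', ← h'.mul_eq] at e1
  exact mul_left_cancel e1

/-- Existence and uniqueness packaged: every `g ∈ GL n k` over a perfect field has a unique
Jordan decomposition (Springer 2.4.5). [cite: SpringerLAG1998, 2.4.5] -/
theorem existsUnique_isJordanDecomp [PerfectField k] (g : GL n k) :
    ∃! su : GL n k × GL n k, IsJordanDecomp g su.1 su.2 := by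
  obtain ⟨s, u, h⟩ := exists_isJordanDecomp g
  refine ⟨(s, u), h, fun su' h' => ?_⟩
  obtain ⟨e1, e2⟩ := h'.unique h
  exact Prod.ext e1 e2

/-- A Jordan decomposition is symmetric in the order of the factors: `g = u s` as well. [folklore] -/
lemma IsJordanDecomp.mul_eq' {g s u : GL n k} (h : IsJordanDecomp g s u) : u * s = g := by
  rw [← h.commute.eq, h.mul_eq]

/-- The parts of a Jordan decomposition commute with everything commuting with `g`... in
particular with `g` itself. [folklore] -/
lemma IsJordanDecomp.commute_left {g s u : GL n k} (h : IsJordanDecomp g s u) : Commute s g := by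
  rw [← h.mul_eq]
  exact (Commute.refl s).mul_right h.commute

end Jordan

end Literature.NumberTheory.Automorphic
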